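import Summits.AtomisticToContinuum.FouriersLaw.Theorems.BondHeatUncertaintyExtensiveSnapshotIrreversibilityEnergyWindowKernelDensityCore
/-!
(SPLIT FOR THE 400-LINE CAP by the landing lane, hand-2 g30: this file = part 1 of 2; sequels `…BondHeatUncertaintyExtensiveSnapshotIrreversibilityEnergyWindowSmoothDuhamel` import it in a chain; same namespace, all FQNs unchanged.)
# Crux `ExtensiveSnapshotIrreversibility` (stmt-AtomisticToContinuum-9121): smooth-core Duhamel

Cell decomp-a2c, lens «grading / quantitative ladder», generation 76, part P (critic row 1057 (2):
«(D) first»).  The record beneath the kernel leaf S3 `KernelTemperatureLipschitz` is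
`S3 ⟸ (D) ∧ (G1ᶜ) ∧ (G1*ᶜ)` (part O).  The Duhamel leaf (D) `KernelTemperatureDuhamel` is typed
for ALL MEASURABLE observables `|h| ≤ e^{θH}`; read that way it silently contains a weighted
`C²`-smoothing statement for the hypoelliptic kernel acting on rough data — the same depth as the
quantitative cores.  This file cuts that out:

* (Dˢ) `KernelTemperatureDuhamelSmooth` — (D) verbatim, restricted to SMOOTH COMPACTLY SUPPORTED
  `h` (`ContDiff ℝ ∞ h`, `HasCompactSupport h`).  WEAKER than (D) (`(D) → (Dˢ)` PROVED, one line)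
  and than the summit.  [INSTRUMENTABLE: for `h ∈ C_c^∞` the regularity of `u_r = P^0_r h` and the
  derivative of the Duhamel path are variational bookkeeping — first/second variation of the flow
  have moments of all orders with `e^{εH}` weights (`‖∇²H‖ ≲ 1 + √H` for the quartic chain, CEHR
  (3.4)), Cerrai's scheme §1.3 with the energy Lyapunov function in place of dissipativity, and
  the tree's Dynkin identity `pinnedChain_dynkin`; no density argument, no hypoellipticity.]
* S3ˢ `KernelTemperatureLipschitzSmooth` — S3 on the same core; ★ `(Dˢ) → (G1) → (G1*) → S3ˢ`
  (part M's split-Duhamel composition, verbatim on the core) and ★ `S3ˢ ↔ S3`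
  (`kernelTemperatureLipschitz_of_smooth`, `kernelTemperatureLipschitzSmooth_of_lipschitz`): the
  constants of S3 are uniform in `h`, both kernels at `z` are finite measures integrating
  `e^{θH}` (CEHR (3.4)), and `C_c^∞ ∩ {|g| ≤ e^{θH}}` is `L¹(P^δ_1(z,·) + P^0_1(z,·))`-dense in the
  measurable `e^{θH}`-ball (`exists_contDiff_hasCompactSupport_integral_sub_le_of_abs_le`:
  continuous compactly supported approximation of `h e^{-θH}`, clipping to `[-1,1]`, mollification
  by a normed bump at a radius given by uniform continuity, multiplication by `e^{θH}`; the
  tree's `Literature.MeasureTheory.Integral.abs_integral_sub_integral_le_mul_of_forall_continuous`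
  is the CONTINUOUS, UNWEIGHTED version of this passage — here the test class is `C_c^∞` and the
  bound carries the Lyapunov weight, so it is re-proved rather than cited).
* ★★ `kernelTemperatureLipschitz_of_smoothDuhamel_of_cores : (Dˢ) → (G1ᶜ) → (G1*ᶜ) → S3` and the
  junction `K_fix ⟸ A0 ∧ A2 ∧ (Dˢ) ∧ (G1ᶜ) ∧ (G1*ᶜ) ∧ A3p ∧ A4`
  (`snapshotKLUpperExpansion_of_atoms₇P`).

So the record beneath S3 now reads: the two weighted small-time kernel-gradient cores (G1ᶜ),
(G1*ᶜ) (OPEN · ATTACKABLE-L, part O) and a Duhamel identity on `C_c^∞` (INSTRUMENTABLE).  The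
cores are `h`-free, so nothing was moved into them.  No new objects.

References: N. Cuneo, J.-P. Eckmann, M. Hairer, L. Rey-Bellet, EJP 23 (2018) no. 55, §3 (3.2),
(3.4); J.-P. Eckmann, M. Hairer, Comm. Math. Phys. 212 (2000) 105–164, §3; S. Cerrai, Second
Order PDE's in Finite and Infinite Dimension, LNM 1762 (2001), §1.3 (first variation,
`⟨D(P_tφ)(x),h⟩ = E⟨Dφ(ξ(t;x)), Dξ(t;x)h⟩`, p. 24); N. Katzourakis, E. Vărvărucă, An Illustrative
Introduction to Modern Analysis (2018), Thm 9.31, Thm 9.44 (density of `C_c`, `C_c^∞`).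
-/

noncomputable section

namespace Summit.AtomisticToContinuum.FouriersLaw.Theorems.ExtensiveSnapshotIrreversibility.EnergyWindow

open MeasureTheory ProbabilityTheory Filter Topology Real intervalIntegral
open scoped ENNReal NNReal ContDiff Convolution
open Literature.MathematicalPhysics.KineticTheory.HeatConduction
open Literature.Probability.Process

/-! ## 1. The Duhamel leaf and the kernel leaf on the smooth core -/

/-- **(Dˢ) `KernelTemperatureDuhamelSmooth`** (INSTRUMENTABLE; WEAKER than (D) and than the
summit): the differentiated second-order perturbation formula of part M, for SMOOTH COMPACTLY
SUPPORTED observables only.  For positive parameters, `T > 0`, `N ≥ 2`, `0 < θ < 1/T` there is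
`δ₀ > 0` such that for `|δ| < δ₀` and every `h ∈ C_c^∞` with `|h| ≤ e^{θH}`: (i) `∂_{p_b} P^0_r h`
is `C¹` for `0 < r ≤ 1` and both bath sites `b`; and for every `z`: (ii) the Duhamel path
`Φ(s) = P^δ_s P^0_{1−s} h(z)` is continuous on `[0, 1]`; (iii) the bath-site integrands
`F_b(s) = ∫ ∂²_{p_b}(P^0_{1−s}h) dP^δ_s(z)` are continuous on `(0, 1)`; (iv)
`Φ'(s) = (γδ/2)(F_0(s) − F_{N−1}(s))` on `(0, 1)`.
(after CuneoEckmannHairerReyBellet2018, §3 eq. (3.2)) (after EckmannHairer2000, §3)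
(after Cerrai2001, §1.3) [route leaf · named hypothesis of this cell, NOT filed as a literature fact] -/
def KernelTemperatureDuhamelSmooth : Prop :=
  ∀ ω₂ lam β γ : ℝ, 0 < ω₂ → 0 < lam → 0 < β → 0 < γ →
    ∀ T : ℝ, 0 < T → ∀ (N : ℕ) (hN : 2 ≤ N), ∀ θ : ℝ, 0 < θ → θ < 1 / T →
      ∃ δ₀ : ℝ, 0 < δ₀ ∧ ∀ δ : ℝ, |δ| < δ₀ →
        ∀ (h : PhaseSpace N → ℝ), ContDiff ℝ ∞ h → HasCompactSupport h →
          (∀ y, |h y| ≤ Real.exp (θ * (pinnedChain ω₂ lam β γ).hamiltonian N y)) →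
          (∀ r : ℝ, 0 < r → r ≤ 1 → ∀ b : Fin N, (b = leftBath N hN ∨ b = rightBath N hN) →
              ContDiff ℝ 1 (partialP b (eqKernelFun ω₂ lam β γ T N h r))) ∧
          ∀ z : PhaseSpace N,
            ContinuousOn (duhamelPath ω₂ lam β γ T δ N h z) (Set.Icc 0 1) ∧
            (∀ b : Fin N, (b = leftBath N hN ∨ b = rightBath N hN) →
                ContinuousOn (duhamelIntegrand ω₂ lam β γ T δ N b h z) (Set.Ioo 0 1)) ∧
            ∀ s ∈ Set.Ioo (0 : ℝ) 1,
              HasDerivAt (duhamelPath ω₂ lam β γ T δ N h z)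
                (γ * δ / 2 * (duhamelIntegrand ω₂ lam β γ T δ N (leftBath N hN) h z s -
                  duhamelIntegrand ω₂ lam β γ T δ N (rightBath N hN) h z s)) s

/-- **S3ˢ `KernelTemperatureLipschitzSmooth`**: the kernel leaf S3 `KernelTemperatureLipschitz`
restricted to smooth compactly supported observables `|h| ≤ e^{θH}` (same constants, uniform in
`h`).  Equivalent to S3 (`kernelTemperatureLipschitz_of_smooth`,
`kernelTemperatureLipschitzSmooth_of_lipschitz`). (after CuneoEckmannHairerReyBellet2018, §3) [route leaf · named hypothesis of this cell, NOT filed as a literature fact] -/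
def KernelTemperatureLipschitzSmooth : Prop :=
  ∀ ω₂ lam β γ : ℝ, 0 < ω₂ → 0 < lam → 0 < β → 0 < γ →
    ∀ T : ℝ, 0 < T → ∀ N : ℕ, 2 ≤ N → ∀ θ θ' : ℝ, 0 < θ → θ < θ' → θ' < 1 / T →
      ∃ δ₀ C : ℝ, 0 < δ₀ ∧ ∀ δ : ℝ, |δ| < δ₀ →
        ∀ (z : PhaseSpace N) (h : PhaseSpace N → ℝ), ContDiff ℝ ∞ h → HasCompactSupport h →
          (∀ y, |h y| ≤ Real.exp (θ * (pinnedChain ω₂ lam β γ).hamiltonian N y)) →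
          |∫ y, h y ∂((pinnedChain ω₂ lam β γ).transitionKernel N (T + δ / 2) (T - δ / 2) 1 z) -
              ∫ y, h y ∂((pinnedChain ω₂ lam β γ).transitionKernel N T T 1 z)| ≤
            C * |δ| * Real.exp (θ' * (pinnedChain ω₂ lam β γ).hamiltonian N z)

/-- `(D) → (Dˢ)`: restriction to the core (a smooth function is measurable). [folklore] -/
theorem kernelTemperatureDuhamelSmooth_of_duhamel (hD : KernelTemperatureDuhamel) :
    KernelTemperatureDuhamelSmooth := by
  intro ω₂ lam β γ hω hl hβ hγ T hT N hN θ hθ hθ1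
  obtain ⟨δ₀, hδ₀, h⟩ := hD ω₂ lam β γ hω hl hβ hγ T hT N hN θ hθ hθ1
  exact ⟨δ₀, hδ₀, fun δ hδ g hgC _ hg => h δ hδ g hgC.continuous.measurable hg⟩

/-- `S3 → S3ˢ`: restriction to the core. [folklore] -/
theorem kernelTemperatureLipschitzSmooth_of_lipschitz (hS : KernelTemperatureLipschitz) :
    KernelTemperatureLipschitzSmooth := by
  intro ω₂ lam β γ hω hl hβ hγ T hT N hN θ θ' hθ hθθ' hθ'1
  obtain ⟨δ₀, C, hδ₀, h⟩ := hS ω₂ lam β γ hω hl hβ hγ T hT N hN θ θ' hθ hθθ' hθ'1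
  exact ⟨δ₀, C, hδ₀, fun δ hδ z g hgC _ hg => h δ hδ z g hgC.continuous.measurable hg⟩

/-! ## 2. ★ `(Dˢ) ∧ (G1) ∧ (G1*) ⟹ S3ˢ` (part M's composition on the core) -/

/-- ★ **`(Dˢ) → (G1) → (G1*) → S3ˢ`**: the proof of part M's
`kernelTemperatureLipschitz_of_duhamelSplit`, run for a smooth compactly supported observable —
(G1) bounds `∂_{p_b} P^0_{1−s} h` by `C₁ (1−s)^{-a} e^{θ₁H}` (`θ₁ = (θ+θ')/2`), (G1*) bounds each
Duhamel integrand by `C₂ s^{-b} C₁ (1−s)^{-a} e^{θ'H(z)}`, the endpoint split makes the derivative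
of the Duhamel path integrable on `(0,1)` and the fundamental theorem of calculus turns (Dˢ) into
`|P^δ_1h(z) − P^0_1h(z)| ≤ (γ|δ|/2) |∫₀¹ 2C₁C₂(2s^{-b} + 2(1−s)^{-a}) ds| e^{θ'H(z)}`. [folklore] -/
theorem kernelTemperatureLipschitzSmooth_of_duhamelSmooth (hD : KernelTemperatureDuhamelSmooth)
    (hG : EqualTemperatureBathGradient) (hI : PerturbedKernelMomentumIBP) :
    KernelTemperatureLipschitzSmooth := by
  intro ω₂ lam β γ hω hl hβ hγ T hT N hN θ θ' hθ hθθ' hθ'1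
  set θ₁ : ℝ := (θ + θ') / 2 with hθ₁
  have hθθ₁ : θ < θ₁ := by rw [hθ₁]; linarith
  have hθ₁θ' : θ₁ < θ' := by rw [hθ₁]; linarith
  have hθ₁1 : θ₁ < 1 / T := hθ₁θ'.trans hθ'1
  obtain ⟨δD, hδD, hDu⟩ := hD ω₂ lam β γ hω hl hβ hγ T hT N hN θ hθ (hθθ'.trans hθ'1)
  obtain ⟨a, C₁, ha1, hG1⟩ := hG ω₂ lam β γ hω hl hβ hγ T hT N hN θ θ₁ hθ hθθ₁ hθ₁1
  obtain ⟨b₀, δI, C₂, hb1, hδI, hI1⟩ :=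
    hI ω₂ lam β γ hω hl hβ hγ T hT N hN θ₁ θ' (hθ.trans hθθ₁) hθ₁θ' hθ'1
  set Hm := (pinnedChain ω₂ lam β γ).hamiltonian N with hHm
  -- the constants are nonnegative (test `h = 0`, `g = 0`)
  have h0m : Measurable (fun _ : PhaseSpace N => (0 : ℝ)) := measurable_const
  have h0b : ∀ y : PhaseSpace N, |(fun _ : PhaseSpace N => (0 : ℝ)) y| ≤ Real.exp (θ * Hm y) :=
    fun y => by simp only [abs_zero]; exact (Real.exp_pos _).le
  set z₀ : PhaseSpace N := (fun _ => 0, fun _ => 0) with hz₀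
  have hC₁ : 0 ≤ C₁ := by
    have h := hG1 1 one_pos le_rfl _ h0m h0b (leftBath N hN) (Or.inl rfl) z₀
    rw [Real.one_rpow, mul_one] at h
    exact nonneg_of_mul_nonneg_left ((abs_nonneg _).trans h) (Real.exp_pos _)
  have hC₂ : 0 ≤ C₂ := by
    have hg0 : ∀ w : PhaseSpace N,
        |(fun _ : PhaseSpace N => (0 : ℝ)) w| ≤ 1 * Real.exp (θ₁ * Hm w) :=
      fun w => by simp only [abs_zero, one_mul]; exact (Real.exp_pos _).le
    have h := hI1 0 (by simpa using hδI) 1 one_pos le_rfl (leftBath N hN) (Or.inl rfl) 1 zero_le_one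
      (fun _ => 0) contDiff_const hg0 z₀
    rw [Real.one_rpow, mul_one, mul_one] at h
    exact nonneg_of_mul_nonneg_left ((abs_nonneg _).trans h) (Real.exp_pos _)
  -- the constant of S3
  set G₀ : ℝ → ℝ := fun s => 2 * (C₁ * C₂) * (2 * s ^ (-b₀) + 2 * (1 - s) ^ (-a)) with hG₀
  have hG₀i : IntervalIntegrable G₀ volume 0 1 := (intervalIntegrable_split ha1 hb1).const_mul _
  refine ⟨min δD δI, γ / 2 * |∫ s in (0 : ℝ)..1, G₀ s|, lt_min hδD hδI,
    fun δ hδ z g hgC hgK hg => ?_⟩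
  have hδD' : |δ| < δD := hδ.trans_le (min_le_left _ _)
  have hδI' : |δ| < δI := hδ.trans_le (min_le_right _ _)
  have hgm : Measurable g := hgC.continuous.measurable
  obtain ⟨hreg, hz⟩ := hDu δ hδD' g hgC hgK hg
  obtain ⟨hcont, hFc, hder⟩ := hz z
  set E : ℝ := Real.exp (θ' * Hm z) with hE
  have hE0 : 0 < E := Real.exp_pos _
  set FL := duhamelIntegrand ω₂ lam β γ T δ N (leftBath N hN) g z with hFL
  set FR := duhamelIntegrand ω₂ lam β γ T δ N (rightBath N hN) g z with hFR
  -- pointwise bound on the Duhamel integrands, `0 < s < 1`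
  have hF : ∀ s : ℝ, 0 < s → s < 1 → ∀ b : Fin N, (b = leftBath N hN ∨ b = rightBath N hN) →
      |duhamelIntegrand ω₂ lam β γ T δ N b g z s| ≤
        C₂ * s ^ (-b₀) * (C₁ * (1 - s) ^ (-a)) * E := by
    intro s hs0 hs1 b hb
    have hr0 : 0 < 1 - s := by linarith
    have hr1 : 1 - s ≤ 1 := by linarith
    have hM : 0 ≤ C₁ * (1 - s) ^ (-a) := mul_nonneg hC₁ (Real.rpow_nonneg hr0.le _)
    exact hI1 δ hδI' s hs0 hs1.le b hb (C₁ * (1 - s) ^ (-a)) hM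
      (partialP b (eqKernelFun ω₂ lam β γ T N g (1 - s))) (hreg (1 - s) hr0 hr1 b hb)
      (fun w => hG1 (1 - s) hr0 hr1 g hgm hg b hb w) z
  have hpt : ∀ s : ℝ, 0 < s → s < 1 → ‖FL s - FR s‖ ≤ G₀ s * E := by
    intro s hs0 hs1
    rw [Real.norm_eq_abs]
    have hL := hF s hs0 hs1 (leftBath N hN) (Or.inl rfl)
    have hR := hF s hs0 hs1 (rightBath N hN) (Or.inr rfl)
    have hsplit := rpow_neg_mul_one_sub_rpow_neg_le ha1.le hb1.le hs0 hs1
    have hCC : 0 ≤ C₁ * C₂ := mul_nonneg hC₁ hC₂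
    calc |FL s - FR s|
        ≤ C₂ * s ^ (-b₀) * (C₁ * (1 - s) ^ (-a)) * E +
            C₂ * s ^ (-b₀) * (C₁ * (1 - s) ^ (-a)) * E := (abs_sub _ _).trans (add_le_add hL hR)
      _ = 2 * (C₁ * C₂) * (s ^ (-b₀) * (1 - s) ^ (-a)) * E := by ring
      _ ≤ 2 * (C₁ * C₂) * (2 * s ^ (-b₀) + 2 * (1 - s) ^ (-a)) * E := by gcongr
      _ = G₀ s * E := by rw [hG₀]
  -- a.e. form on `uIoc 0 1` (the endpoint `s = 1` is a null set: pass to `Ioo 0 1`)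
  have hae : ∀ᵐ s ∂(volume.restrict (Set.uIoc (0 : ℝ) 1)), ‖FL s - FR s‖ ≤ G₀ s * E := by
    rw [Set.uIoc_of_le zero_le_one, ← Measure.restrict_congr_set Ioo_ae_eq_Ioc]
    filter_upwards [ae_restrict_mem measurableSet_Ioo] with s hs
    exact hpt s hs.1 hs.2
  have hFm :
      AEStronglyMeasurable (fun s => FL s - FR s) (volume.restrict (Set.uIoc (0 : ℝ) 1)) := by
    rw [Set.uIoc_of_le zero_le_one, ← Measure.restrict_congr_set Ioo_ae_eq_Ioc]
    exact ((hFc _ (Or.inl rfl)).sub (hFc _ (Or.inr rfl))).aestronglyMeasurable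
      measurableSet_Ioo
  have hFi : IntervalIntegrable (fun s => FL s - FR s) volume 0 1 :=
    (hG₀i.mul_const E).mono_fun' hFm hae
  -- the fundamental theorem of calculus along the Duhamel path
  have hftc := intervalIntegral.integral_eq_sub_of_hasDerivAt_of_le zero_le_one hcont
    (fun s hs => hder s hs) (hFi.const_mul (γ * δ / 2))
  rw [duhamelPath_zero hω hl hβ hγ, duhamelPath_one hω hl hβ hγ,
    intervalIntegral.integral_const_mul] at hftc
  have hint : ‖∫ s in (0 : ℝ)..1, (FL s - FR s)‖ ≤ |∫ s in (0 : ℝ)..1, G₀ s * E| :=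
    intervalIntegral.norm_integral_le_abs_of_norm_le hae (hG₀i.mul_const E)
  rw [intervalIntegral.integral_mul_const, Real.norm_eq_abs, abs_mul, abs_of_pos hE0] at hint
  -- assemble
  rw [← hftc, abs_mul, show |γ * δ / 2| = γ / 2 * |δ| by
    rw [abs_div, abs_mul, abs_of_pos hγ, abs_two]; ring]
  calc γ / 2 * |δ| * |∫ s in (0 : ℝ)..1, (FL s - FR s)|
      ≤ γ / 2 * |δ| * (|∫ s in (0 : ℝ)..1, G₀ s| * E) :=
        mul_le_mul_of_nonneg_left hint (by positivity)
    _ = γ / 2 * |∫ s in (0 : ℝ)..1, G₀ s| * |δ| * E := by ring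

end Summit.AtomisticToContinuum.FouriersLaw.Theorems.ExtensiveSnapshotIrreversibility.EnergyWindow

end
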